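import Summits.HodgeConjecture.HodgeConjecture.Theorems.F0P3HatLawsOfAnchoredPackets   -- ★ (B-p12 (g26), T1-RES): `hatLaws_of_frame_of_anchored`, `hatBounded_of_pins_of_anchored`, `unrStarAlgebra_of_pins_of_anchored`
import Summits.HodgeConjecture.HodgeConjecture.Theorems.F0P3KitOfRecordClosed           -- ★ (K1′): `isPinned_kitOfRecord₀` (+ ★ K0 `kitOfRecord`, ★ «RC» `ramCls₀`)
import HarnessLib

/-!
# T1-RES AT THE KIT OF RECORD: rows #6 `HatBounded S₀` and #7 `UnrStarAlgebra S₀` of `𝔠₀ = kitOfRecord …` FROM THE PACKET ANCHORS ALONE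

Cell `hodgecm-mathlib`, F0∕P3 «U3-mult», crux H413 (`stmt-HodgeConjecture-24833`), row «T1-RES» (#101; director s599∕s606 (2), F0P3-plan (g6) «=» 16:57:25Z condition (b)).
B-p12 (g26).  PROOF lane: no `def`, no `sorry`, no named fact; `--supports stmt-HodgeConjecture-24833 --as helper`.

★ `F0P3HatLawsOfAnchoredPackets` proves the two (L1) laws for the WHOLE `AutGerm` kit-parametrically from the pins and PACKET ANCHORS in pin-(ii)(iv)(v) currency.
THIS FILE instantiates it at the kit of record ★ K0 `kitOfRecord L H ι T hT μ 𝔰 gh ξd μω c jInf dsInf archTr ν μv ramCls₀` — whose pins are ★ K1′ `isPinned_kitOfRecord₀`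
(NO hypothesis beyond the compact CM frame `hdef h2` and the Haar family `hμv`) and whose packet side is `ξd.evpG ∕ ξd.evpH ∕ ξd.ramG ∕ ξd.ramH` (★ K0 read-backs, `rfl`) —
so that the ONLY remaining hypotheses are the two anchor clauses, typed over the `XiSide` and the Haar family:

  `hG : ∀ Q v, v ∉ S₀ → v ∉ ξd.ramG Q → ∃ π : IrrClass (G′_v), π.IsAdmissible ∧ π.IsUnitarizable ∧ π.IsSphericalWith K_v (μv v) (ξd.evpG Q v)`   (`hH` likewise).

The K9β closer's kit `kitK9 … 𝔨 ov gh evpG evpH ramG ramH PiXi ρXi` (`Cruxes/H413/Lines/F0_U3LettersRung1.lean` §B) IS `kitOfRecord` at `𝔰 := socketsOfT1 (𝔨.override ov)`,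
`ξd := xiSideOfRecord … evpG evpH ramG ramH PiXi ρXi`, `μv := νG` (reducibly), so at a later closer edition the two PRINT fields `OverrideWitness.hatBounded ∕ .unrStarAlgebra`
can be replaced by the anchor fields (text of `hG`∕`hH` at `evpG ∕ ramG ∕ νG`) and §D reads `⟨h6, h7⟩ := hatLaws_kitOfRecord_of_anchored … hdef h2 hμv OW.anchG OW.anchH`
(Theorems never import Lines, hence the corollary is stated at ★ K0, not at the Lines-side abbreviation `kitK9`).

* `hatBounded_kitOfRecord_of_anchored (hdef h2 hμv) (hG hH) : HatBounded 𝔠₀ S₀` [Langlands1980 p. 209].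
* `unrStarAlgebra_kitOfRecord_of_anchored (hdef h2 hμv) (hG hH) : UnrStarAlgebra 𝔠₀ S₀` [CartierCorvallis1979 §IV.1 Cor. 4.1].
* `hatLaws_kitOfRecord_of_anchored (hdef h2 hμv) (hG hH) : HatBounded 𝔠₀ S₀ ∧ UnrStarAlgebra 𝔠₀ S₀` — rows #6 ∧ #7, the shape §D consumes.

References: [Rogawski1990] §13.7 p. 206; [Langlands1980] p. 209; [CartierCorvallis1979] §IV.1 Cor. 4.1–4.2.
HONEST LABEL: HC_CM is proved only modulo the printed citations until rung 0 closes.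
-/

set_option autoImplicit false
-- project-wide idiom for `Summit.HodgeConjecture.HodgeConjecture.…` (summit = problem name): the namespace IS duplicated
set_option linter.dupNamespace false

noncomputable section

open MeasureTheory NumberField IsDedekindDomain Literature.NumberTheory.Automorphic Literature.NumberTheory.Automorphic.UnitaryGroup
open Literature.NumberTheory.GaloisRepresentations (HeckeCharacter)
open Summit.HodgeConjecture.HodgeConjecture.Cruxes.H413.F0P3InnerFormClassificationV6 (Gp Places EvpData Cinf Sockets)
open Summit.HodgeConjecture.HodgeConjecture.Cruxes.H413.F0P3KitOfRecord (kitOfRecord GHSide XiSide isPinned_kitOfRecord₀)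
open Summit.HodgeConjecture.HodgeConjecture.Cruxes.H413.F0P3RamClsOfRecord (ramCls₀)
open Summit.HodgeConjecture.HodgeConjecture.Cruxes.H413.F0P3HatLawsOfAnchoredPackets (hatBounded_of_pins_of_anchored unrStarAlgebra_of_frame_of_anchored)
open scoped Matrix ComplexOrder

namespace Summit.HodgeConjecture.HodgeConjecture.Cruxes.H413.F0P3HatLawsKitK9

variable (L : Type) [Field L] [NumberField L] [IsCMField L] (H : Matrix (Fin 3) (Fin 3) L) (ι : L →+* ℂ) (T : GL (Fin 3) ℂ)
  (hT : (T : Matrix (Fin 3) (Fin 3) ℂ)ᴴ * H.map ι * (T : Matrix (Fin 3) (Fin 3) ℂ) = Literature.Geometry.ComplexHyperbolic.BallModel.J)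
  (μ : Measure (Gp L H).automorphicQuotient) [(Gp L H).IsAutomorphicMeasure μ]
  [MeasurableSpace (Gp L H).Adelic] [BorelSpace (Gp L H).Adelic]
  (𝔰 : Sockets L H μ) (gh : GHSide L H ι T hT 𝔰.PacketG 𝔰.PacketH) (ξd : XiSide L H 𝔰.PacketG 𝔰.PacketH)
  (μω : HeckeCharacter L) (c : ℚ) (jInf dsInf : ℤ → ℤ → ℤ → Cinf)
  (archTr : Cinf → (UnitaryGroup.arch (↥(maximalRealSubfield L)) L (IsCMField.complexConj L) 3 H → ℂ) → ℂ)
  (ν : Measure (Gp L H).Adelic) [IsFiniteMeasureOnCompacts ν]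
  (μv : ∀ v : Places L, @Measure ((cmDatum L 3 H).Local v) (borel _))

/-- **Row #6 `HatBounded S₀` at the kit of record, from the packet anchors** (pins ★ `isPinned_kitOfRecord₀`; ★ `hatBounded_of_pins_of_anchored`).
[cite: Langlands1980, p. 209] [cite: Rogawski1990, §13.7 p. 206] -/
theorem hatBounded_kitOfRecord_of_anchored
    (hdef : ∀ τ' : L →+* ℂ, InfinitePlace.mk τ' ≠ InfinitePlace.mk ι → (H.map τ').PosDef) (h2 : 2 ≤ Module.finrank ℚ ↥(maximalRealSubfield L))
    (hμv : ∀ v : Places L, letI : MeasurableSpace ((cmDatum L 3 H).Local v) := borel _; (μv v).IsHaarMeasure)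
    {S₀ : Finset (Places L)}
    (hG : ∀ (Q : 𝔰.PacketG) (v : Places L), v ∉ S₀ → v ∉ ξd.ramG Q →
      letI : MeasurableSpace ((cmDatum L 3 H).Local v) := borel _
      ∃ π : IrrClass ((cmDatum L 3 H).Local v), π.IsAdmissible ∧ π.IsUnitarizable ∧
        π.IsSphericalWith (cmLocalIntegralLevel L 3 H v) (μv v) (ξd.evpG Q v))
    (hH : ∀ (ρ : 𝔰.PacketH) (v : Places L), v ∉ S₀ → v ∉ ξd.ramH ρ →
      letI : MeasurableSpace ((cmDatum L 3 H).Local v) := borel _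
      ∃ π : IrrClass ((cmDatum L 3 H).Local v), π.IsAdmissible ∧ π.IsUnitarizable ∧
        π.IsSphericalWith (cmLocalIntegralLevel L 3 H v) (μv v) (ξd.evpH ρ v)) :
    F0P3InnerFormClassificationV8.ClassificationKit.HatBounded (kitOfRecord L H ι T hT μ 𝔰 gh ξd μω c jInf dsInf archTr ν μv ramCls₀) S₀ :=
  hatBounded_of_pins_of_anchored _ (isPinned_kitOfRecord₀ L H ι T hT μ 𝔰 gh ξd μω c jInf dsInf archTr ν μv hdef h2 hμv) hG hH

/-- **Row #7 `UnrStarAlgebra S₀` at the kit of record, from the packet anchors** (pins ★ `isPinned_kitOfRecord₀`, anisotropy ★ `hanis_of_frame hdef h2`; ★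
`unrStarAlgebra_of_frame_of_anchored`). [cite: CartierCorvallis1979, §IV.1 Cor. 4.1] [cite: Rogawski1990, §13.7 p. 206] -/
theorem unrStarAlgebra_kitOfRecord_of_anchored
    (hdef : ∀ τ' : L →+* ℂ, InfinitePlace.mk τ' ≠ InfinitePlace.mk ι → (H.map τ').PosDef) (h2 : 2 ≤ Module.finrank ℚ ↥(maximalRealSubfield L))
    (hμv : ∀ v : Places L, letI : MeasurableSpace ((cmDatum L 3 H).Local v) := borel _; (μv v).IsHaarMeasure)
    {S₀ : Finset (Places L)}
    (hG : ∀ (Q : 𝔰.PacketG) (v : Places L), v ∉ S₀ → v ∉ ξd.ramG Q →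
      letI : MeasurableSpace ((cmDatum L 3 H).Local v) := borel _
      ∃ π : IrrClass ((cmDatum L 3 H).Local v), π.IsAdmissible ∧ π.IsUnitarizable ∧
        π.IsSphericalWith (cmLocalIntegralLevel L 3 H v) (μv v) (ξd.evpG Q v))
    (hH : ∀ (ρ : 𝔰.PacketH) (v : Places L), v ∉ S₀ → v ∉ ξd.ramH ρ →
      letI : MeasurableSpace ((cmDatum L 3 H).Local v) := borel _
      ∃ π : IrrClass ((cmDatum L 3 H).Local v), π.IsAdmissible ∧ π.IsUnitarizable ∧
        π.IsSphericalWith (cmLocalIntegralLevel L 3 H v) (μv v) (ξd.evpH ρ v)) :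
    F0P3InnerFormClassificationV8.ClassificationKit.UnrStarAlgebra (kitOfRecord L H ι T hT μ 𝔰 gh ξd μω c jInf dsInf archTr ν μv ramCls₀) S₀ :=
  unrStarAlgebra_of_frame_of_anchored _ (isPinned_kitOfRecord₀ L H ι T hT μ 𝔰 gh ξd μω c jInf dsInf archTr ν μv hdef h2 hμv) hdef h2 hG hH

/-- **ROWS #6 ∧ #7 AT THE KIT OF RECORD FROM THE PACKET ANCHORS — the shape §D of the K9β closer consumes** (`⟨h6, h7⟩`; at `kitK9` = `kitOfRecord` at
`socketsOfT1 (𝔨.override ov)`, `xiSideOfRecord … evpG evpH ramG ramH PiXi ρXi`, `νG`). [cite: Langlands1980, p. 209] [cite: CartierCorvallis1979, §IV.1 Cor. 4.1–4.2]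
[cite: Rogawski1990, §13.7 p. 206] -/
theorem hatLaws_kitOfRecord_of_anchored
    (hdef : ∀ τ' : L →+* ℂ, InfinitePlace.mk τ' ≠ InfinitePlace.mk ι → (H.map τ').PosDef) (h2 : 2 ≤ Module.finrank ℚ ↥(maximalRealSubfield L))
    (hμv : ∀ v : Places L, letI : MeasurableSpace ((cmDatum L 3 H).Local v) := borel _; (μv v).IsHaarMeasure)
    {S₀ : Finset (Places L)}
    (hG : ∀ (Q : 𝔰.PacketG) (v : Places L), v ∉ S₀ → v ∉ ξd.ramG Q →
      letI : MeasurableSpace ((cmDatum L 3 H).Local v) := borel _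
      ∃ π : IrrClass ((cmDatum L 3 H).Local v), π.IsAdmissible ∧ π.IsUnitarizable ∧
        π.IsSphericalWith (cmLocalIntegralLevel L 3 H v) (μv v) (ξd.evpG Q v))
    (hH : ∀ (ρ : 𝔰.PacketH) (v : Places L), v ∉ S₀ → v ∉ ξd.ramH ρ →
      letI : MeasurableSpace ((cmDatum L 3 H).Local v) := borel _
      ∃ π : IrrClass ((cmDatum L 3 H).Local v), π.IsAdmissible ∧ π.IsUnitarizable ∧
        π.IsSphericalWith (cmLocalIntegralLevel L 3 H v) (μv v) (ξd.evpH ρ v)) :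
    F0P3InnerFormClassificationV8.ClassificationKit.HatBounded (kitOfRecord L H ι T hT μ 𝔰 gh ξd μω c jInf dsInf archTr ν μv ramCls₀) S₀ ∧
      F0P3InnerFormClassificationV8.ClassificationKit.UnrStarAlgebra (kitOfRecord L H ι T hT μ 𝔰 gh ξd μω c jInf dsInf archTr ν μv ramCls₀) S₀ :=
  ⟨hatBounded_kitOfRecord_of_anchored L H ι T hT μ 𝔰 gh ξd μω c jInf dsInf archTr ν μv hdef h2 hμv hG hH,
    unrStarAlgebra_kitOfRecord_of_anchored L H ι T hT μ 𝔰 gh ξd μω c jInf dsInf archTr ν μv hdef h2 hμv hG hH⟩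

end Summit.HodgeConjecture.HodgeConjecture.Cruxes.H413.F0P3HatLawsKitK9

end
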